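import Summits.PneNP.PneNP.Theorems.ExpanderLinearGeneratorsResolutionNFreeMaster
import HarnessLib

/-!
# The n-free resolution-size rung for expanding linear systems, XV: counting in the product sample space

Support file for crux `stmt-PneNP-11442`
(`Summit.PneNP.PneNP.Theses.ExpanderLinearGenerators.ExpansionForcesDepthFregeSize`, the
EXPANSION-SCALE LAW, uniform in the numbers `n` of variables and `m` of rows). Files IX–XII
proved the n-free, m-free EXPONENTIAL resolution-size law at bounded column weight (Theorem C,
`resolution_size_nfree_column`) by an ALTERED load-bounded random restriction and a union bound.
File XVI replaces the union bound by the Lovász Local Lemma, which needs the bad events to be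
determined by few coordinates of a PRODUCT space; this file supplies the counting on the product
sample space `Fin n → Fin (K+1) × Bool` (a sample `ω` encodes the restriction `ρ_ω` assigning
`(ω v).2` to the variables `v < n` with `(ω v).1 = 0`, rate `1/(K+1)`, and `false` above `n`):

* `card_le_of_forall_mem` — functions with values in a prescribed set on `P`;
* `card_overload_pi_le` — a row of support `≤ ℓ` is overloaded (`> L` variables assigned) on
  at most a `2^ℓ/(K+1)^{L+1}` fraction of the samples;
* `card_unsat_pi_le` — a clause on `v` variables `< n` is left unsatisfied on at most a
  `((2K+1)/(2K+2))^v` fraction; `lt_two_mul_card_vars` — a line with `> W` free literals has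
  `> W/2` variables `< n`;
* `satisfiedBy_congr`, `restrictClause_congr` — both depend only on the restriction at the
  variables of the clause; `prod_le_prod_of_subset_of_unit` — products of factors in `[0,1]`.

References: P. Beame, T. Pitassi, FOCS 1996 (restriction method); E. Ben-Sasson, A. Wigderson,
J. ACM 48 (2001), §3; N. Alon, J. Spencer, *The Probabilistic Method*, Ch. 5.
-/

namespace Summit.PneNP.PneNP.Theorems.ResNFree

set_option linter.dupNamespace false -- `Summit.PneNP.PneNP.…`: summit = sub-problem (D-0017)

open Finset Literature.Computability.Complexity Literature.Computability.MetaComplexity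
open Summit.PneNP.PneNP.Theorems.ResKRestriction
/-! ### Counting in the product sample space -/

section Counting

variable {ι κ : Type*} [Fintype ι] [DecidableEq ι] [Fintype κ]

/-- **Functions with values in a prescribed set on each point of `P`** number at most
`|B|^{|P|} |κ|^{|ι| - |P|}` (exact product count over `Fintype.piFinset`). [folklore] -/
theorem card_le_of_forall_mem (P : Finset ι) (B : Finset κ) (s : Finset (ι → κ))
    (hs : ∀ f ∈ s, ∀ i ∈ P, f i ∈ B) :
    s.card ≤ B.card ^ P.card * Fintype.card κ ^ (Fintype.card ι - P.card) := by
  classical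
  set t : ι → Finset κ := fun i => if i ∈ P then B else univ with ht
  have hsub : s ⊆ Fintype.piFinset t := by
    intro f hf
    rw [Fintype.mem_piFinset]
    intro i
    by_cases hi : i ∈ P
    · simp only [ht, if_pos hi]; exact hs f hf i hi
    · simp only [ht, if_neg hi]; exact mem_univ _
  refine (card_le_card hsub).trans (le_of_eq ?_)
  rw [Fintype.card_piFinset]
  have h1 : ∀ i, (t i).card = if i ∈ P then B.card else Fintype.card κ := by
    intro i
    by_cases hi : i ∈ P
    · simp only [ht, if_pos hi]
    · simp only [ht, if_neg hi, card_univ]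
  simp_rw [h1]
  rw [prod_ite, prod_const, prod_const]
  congr 2
  · rw [filter_mem_eq_inter, univ_inter]
  · rw [filter_not, filter_mem_eq_inter, univ_inter, card_univ_sdiff]

end Counting

variable {m n : ℕ}

/-- The size of the product sample space `Fin n → Fin (K+1) × Bool`. [folklore] -/
theorem card_sample_pi (n K : ℕ) :
    Fintype.card (Fin n → Fin (K + 1) × Bool) = (2 * K + 2) ^ n := by
  rw [Fintype.card_fun, Fintype.card_prod, Fintype.card_fin, Fintype.card_fin, Fintype.card_bool]
  congr 1
  ring

/-- **Overloaded rows are rare (product space).** For a row support `S` of size `≤ ℓ`, the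
samples `ω` with `(ω j).1 = 0` for at least `L + 1` points `j ∈ S` form at most a
`2^ℓ/(K+1)^{L+1}` fraction of the space. [Beame–Pitassi 1996; folklore] -/
theorem card_overload_pi_le {K ℓ L : ℕ} (S : Finset (Fin n)) (hS : S.card ≤ ℓ)
    (s : Finset (Fin n → Fin (K + 1) × Bool))
    (hs : ∀ ω ∈ s, L + 1 ≤ (S.filter fun j => (ω j).1 = 0).card) :
    (s.card : ℝ) * ((K : ℝ) + 1) ^ (L + 1)
      ≤ (2 : ℝ) ^ ℓ * Fintype.card (Fin n → Fin (K + 1) × Bool) := by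
  classical
  rw [card_sample_pi]
  by_cases hn : L + 1 ≤ n
  swap
  · have hs0 : s = ∅ := by
      rw [Finset.eq_empty_iff_forall_notMem]
      intro ω hω
      have h1 := hs ω hω
      have h2 : (S.filter fun j => (ω j).1 = 0).card ≤ n :=
        (card_le_univ _).trans (by rw [Fintype.card_fin])
      omega
    rw [hs0, card_empty]
    push_cast
    rw [zero_mul]
    positivity
  -- cover `s` by the sub-families with `L + 1` prescribed zeros
  set B : Finset (Fin n) → Finset (Fin n → Fin (K + 1) × Bool) :=
    fun T => univ.filter fun ω => ∀ j ∈ T, (ω j).1 = 0 with hB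
  have hcov : s ⊆ (S.powersetCard (L + 1)).biUnion B := by
    intro ω hω
    obtain ⟨T, hT, hTc⟩ := Finset.exists_subset_card_eq (hs ω hω)
    refine mem_biUnion.2 ⟨T, mem_powersetCard.2 ⟨hT.trans (filter_subset _ _), hTc⟩, ?_⟩
    simp only [hB, mem_filter, mem_univ, true_and]
    exact fun j hj => (mem_filter.1 (hT hj)).2
  -- the values with first component `0`
  set Z : Finset (Fin (K + 1) × Bool) := univ.filter fun p => p.1 = 0 with hZ
  have hZcard : Z.card = 2 := by
    have hZeq : Z = ({(0 : Fin (K + 1))} : Finset (Fin (K + 1))) ×ˢ (univ : Finset Bool) := by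
      ext p
      simp only [hZ, mem_filter, mem_univ, true_and, mem_product, mem_singleton, and_true]
    rw [hZeq, card_product, card_singleton, card_univ, Fintype.card_bool]
  have hone : ∀ T ∈ S.powersetCard (L + 1),
      (B T).card ≤ 2 ^ (L + 1) * (2 * K + 2) ^ (n - (L + 1)) := by
    intro T hT
    have hTc : T.card = L + 1 := (mem_powersetCard.1 hT).2
    have h := card_le_of_forall_mem T Z (B T) (fun f hf i hi => by
      simp only [hZ, mem_filter, mem_univ, true_and]
      have hf' := (mem_filter.1 hf).2
      exact hf' i hi)
    rw [hZcard, hTc, Fintype.card_prod, Fintype.card_fin, Fintype.card_fin, Fintype.card_bool]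
      at h
    have h2 : (K + 1) * 2 = 2 * K + 2 := by ring
    rwa [h2] at h
  have hcount : s.card ≤ 2 ^ ℓ * (2 ^ (L + 1) * (2 * K + 2) ^ (n - (L + 1))) :=
    calc s.card ≤ ((S.powersetCard (L + 1)).biUnion B).card := card_le_card hcov
      _ ≤ ∑ T ∈ S.powersetCard (L + 1), (B T).card := card_biUnion_le
      _ ≤ ∑ T ∈ S.powersetCard (L + 1), 2 ^ (L + 1) * (2 * K + 2) ^ (n - (L + 1)) :=
          sum_le_sum hone
      _ = (S.card.choose (L + 1)) * (2 ^ (L + 1) * (2 * K + 2) ^ (n - (L + 1))) := by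
          rw [sum_const, smul_eq_mul, card_powersetCard]
      _ ≤ 2 ^ ℓ * (2 ^ (L + 1) * (2 * K + 2) ^ (n - (L + 1))) := by
          refine Nat.mul_le_mul_right _ ?_
          exact (Nat.choose_le_two_pow _ _).trans (Nat.pow_le_pow_right (by norm_num) hS)
  have h1 : (s.card : ℝ) ≤ (2 : ℝ) ^ ℓ * ((2 : ℝ) ^ (L + 1) * (2 * (K : ℝ) + 2) ^ (n - (L + 1))) := by
    exact_mod_cast hcount
  have h2 : (2 * (K : ℝ) + 2) ^ (n - (L + 1)) * (2 * (K : ℝ) + 2) ^ (L + 1)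
      = (2 * (K : ℝ) + 2) ^ n := by
    rw [← pow_add, Nat.sub_add_cancel hn]
  have h3 : (2 : ℝ) ^ (L + 1) * ((K : ℝ) + 1) ^ (L + 1) = (2 * (K : ℝ) + 2) ^ (L + 1) := by
    rw [← mul_pow]; congr 1; ring
  calc (s.card : ℝ) * ((K : ℝ) + 1) ^ (L + 1)
      ≤ (2 : ℝ) ^ ℓ * ((2 : ℝ) ^ (L + 1) * (2 * (K : ℝ) + 2) ^ (n - (L + 1)))
          * ((K : ℝ) + 1) ^ (L + 1) := mul_le_mul_of_nonneg_right h1 (by positivity)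
    _ = (2 : ℝ) ^ ℓ * ((2 * (K : ℝ) + 2) ^ (n - (L + 1))
          * ((2 : ℝ) ^ (L + 1) * ((K : ℝ) + 1) ^ (L + 1))) := by ring
    _ = (2 : ℝ) ^ ℓ * ((2 * K + 2) ^ n : ℕ) := by
        rw [h3, h2]; push_cast; ring

/-- **Unsatisfied lines are rare (product space).** Fix a clause `C` and, for a sample `ω`, the
restriction `ρ_ω` assigning `(ω v).2` to the variables `v < n` with `(ω v).1 = 0` and `false` to
all variables `≥ n`. The samples under which `C` is not satisfied form at most a
`((2K+1)/(2K+2))^{v}` fraction of the space, `v` the number of variables `< n` of `C`: on each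
of them the sample avoids the one value that would satisfy `C`. [Beame–Pitassi 1996; folklore] -/
theorem card_unsat_pi_le {K : ℕ} (C : Finset (Literal ℕ))
    (s : Finset (Fin n → Fin (K + 1) × Bool))
    (hs : ∀ ω ∈ s, ¬ SatisfiedBy (fun v => if h : v < n then
        (if (ω ⟨v, h⟩).1 = 0 then some (ω ⟨v, h⟩).2 else none) else some false) C) :
    (s.card : ℝ) ≤ ((2 * (K : ℝ) + 1) / (2 * K + 2)) ^
        (univ.filter fun j : Fin n => ((j : ℕ), true) ∈ C ∨ ((j : ℕ), false) ∈ C).card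
      * Fintype.card (Fin n → Fin (K + 1) × Bool) := by
  classical
  rw [card_sample_pi]
  set V : Finset (Fin n) := univ.filter fun j => ((j : ℕ), true) ∈ C ∨ ((j : ℕ), false) ∈ C
    with hV
  set g : Fin n → Fin (K + 1) × Bool := fun j => (0, decide (((j : ℕ), true) ∈ C)) with hg
  have hgC : ∀ j ∈ V, (((j : ℕ), (g j).2) : Literal ℕ) ∈ C := by
    intro j hj
    have hj' := (mem_filter.1 hj).2
    by_cases ht : ((j : ℕ), true) ∈ C
    · simp [hg, ht]
    · simpa [hg, ht] using hj'.resolve_left ht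
  -- a sample under which `C` is unsatisfied avoids the satisfying value on every variable of `C`
  have havoid : ∀ ω ∈ s, ∀ j ∈ V, ω j ≠ g j := by
    intro ω hω j hj heq
    refine hs ω hω ⟨((j : ℕ), (g j).2), hgC j hj, ?_⟩
    have h0 : (ω j).1 = 0 := by rw [heq]
    have hval : (ω j).2 = (g j).2 := by rw [heq]
    simp only [j.2, ↓reduceDIte, Fin.eta, h0, ↓reduceIte, hval]
  have hcard : s.card ≤ (Fintype.card (Fin (K + 1) × Bool) - 1) ^ V.card *
      Fintype.card (Fin (K + 1) × Bool) ^ (Fintype.card (Fin n) - V.card) :=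
    card_le_of_forall_ne V g s havoid
  rw [Fintype.card_prod, Fintype.card_fin, Fintype.card_bool, Fintype.card_fin] at hcard
  have hvn : V.card ≤ n := (card_le_univ _).trans (by rw [Fintype.card_fin])
  have h1 : (s.card : ℝ) ≤ (2 * (K : ℝ) + 1) ^ V.card * (2 * (K : ℝ) + 2) ^ (n - V.card) := by
    have e1 : ((K + 1) * 2 - 1 : ℕ) = 2 * K + 1 := by omega
    have e2 : ((K + 1) * 2 : ℕ) = 2 * K + 2 := by ring
    rw [e1, e2] at hcard
    exact_mod_cast hcard
  have hpos : (0 : ℝ) < 2 * (K : ℝ) + 2 := by positivity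
  have hratio : (2 * (K : ℝ) + 1) ^ V.card * (2 * (K : ℝ) + 2) ^ (n - V.card)
      = ((2 * (K : ℝ) + 1) / (2 * K + 2)) ^ V.card * (2 * (K : ℝ) + 2) ^ n := by
    rw [div_pow, div_mul_eq_mul_div, eq_div_iff (by positivity), mul_assoc, ← pow_add,
      Nat.sub_add_cancel hvn]
  calc (s.card : ℝ) ≤ (2 * (K : ℝ) + 1) ^ V.card * (2 * (K : ℝ) + 2) ^ (n - V.card) := h1
    _ = ((2 * (K : ℝ) + 1) / (2 * K + 2)) ^ V.card * (2 * (K : ℝ) + 2) ^ n := hratio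
    _ = ((2 * (K : ℝ) + 1) / (2 * K + 2)) ^ V.card * ((2 * K + 2) ^ n : ℕ) := by push_cast; ring

/-- A line keeping more than `W` literals unassigned under a restriction total above `n` has
literals on more than `W/2` variables `< n`. [folklore] -/
theorem lt_two_mul_card_vars {W : ℕ} (C : Finset (Literal ℕ)) (ρ : ℕ → Option Bool)
    (hρ : ∀ v, ¬ v < n → ρ v ≠ none) (hW : W < (restrictClause ρ C).card) :
    W < 2 * (univ.filter fun j : Fin n => ((j : ℕ), true) ∈ C ∨ ((j : ℕ), false) ∈ C).card := by
  classical
  set V : Finset (Fin n) := univ.filter fun j => ((j : ℕ), true) ∈ C ∨ ((j : ℕ), false) ∈ C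
    with hV
  have hsub : restrictClause ρ C
      ⊆ (V ×ˢ (univ : Finset Bool)).image fun p => (((p.1 : ℕ), p.2) : Literal ℕ) := by
    intro l hl
    obtain ⟨hlC, hnone⟩ := mem_restrictClause.1 hl
    have hln : l.1 < n := by
      by_contra h
      exact hρ l.1 h hnone
    refine mem_image.2 ⟨(⟨l.1, hln⟩, l.2), mem_product.2 ⟨?_, mem_univ _⟩, ?_⟩
    · refine mem_filter.2 ⟨mem_univ _, ?_⟩
      rcases hb : l.2 with _ | _
      · right; have : l = (l.1, false) := by ext <;> simp [hb]
        rw [this] at hlC; exact hlC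
      · left; have : l = (l.1, true) := by ext <;> simp [hb]
        rw [this] at hlC; exact hlC
    · ext <;> simp
  calc W < (restrictClause ρ C).card := hW
    _ ≤ ((V ×ˢ (univ : Finset Bool)).image fun p => (((p.1 : ℕ), p.2) : Literal ℕ)).card :=
        card_le_card hsub
    _ ≤ (V ×ˢ (univ : Finset Bool)).card := card_image_le
    _ = 2 * V.card := by rw [card_product, card_univ, Fintype.card_bool, mul_comm]

/-! ### Restrictions agreeing on the variables of a clause -/

/-- `SatisfiedBy` only depends on the restriction at the variables of the clause. [folklore] -/
theorem satisfiedBy_congr {ρ ρ' : ℕ → Option Bool} {C : Finset (Literal ℕ)}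
    (h : ∀ l ∈ C, ρ l.1 = ρ' l.1) : SatisfiedBy ρ C ↔ SatisfiedBy ρ' C := by
  unfold SatisfiedBy
  constructor
  · rintro ⟨l, hl, hsat⟩; exact ⟨l, hl, by rw [← h l hl]; exact hsat⟩
  · rintro ⟨l, hl, hsat⟩; exact ⟨l, hl, by rw [h l hl]; exact hsat⟩

/-- `restrictClause` only depends on the restriction at the variables of the clause.
[folklore] -/
theorem restrictClause_congr {ρ ρ' : ℕ → Option Bool} {C : Finset (Literal ℕ)}
    (h : ∀ l ∈ C, ρ l.1 = ρ' l.1) : restrictClause ρ C = restrictClause ρ' C := by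
  ext l
  simp only [mem_restrictClause]
  constructor
  · rintro ⟨hl, hn⟩; exact ⟨hl, by rw [← h l hl]; exact hn⟩
  · rintro ⟨hl, hn⟩; exact ⟨hl, by rw [h l hl]; exact hn⟩

/-! ### Products of factors in `[0, 1]` -/

/-- A product of factors in `[0, 1]` over a larger set is smaller. [folklore] -/
theorem prod_le_prod_of_subset_of_unit {ι : Type*} [DecidableEq ι] {s t : Finset ι} {f : ι → ℝ}
    (hst : s ⊆ t) (h0 : ∀ i ∈ t, 0 ≤ f i) (h1 : ∀ i ∈ t, f i ≤ 1) :
    ∏ i ∈ t, f i ≤ ∏ i ∈ s, f i := by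
  rw [← prod_sdiff hst]
  have ha : ∏ i ∈ t \ s, f i ≤ 1 :=
    prod_le_one (fun i hi => h0 i (sdiff_subset hi)) fun i hi => h1 i (sdiff_subset hi)
  have hb : 0 ≤ ∏ i ∈ s, f i := prod_nonneg fun i hi => h0 i (hst hi)
  calc (∏ i ∈ t \ s, f i) * ∏ i ∈ s, f i ≤ 1 * ∏ i ∈ s, f i :=
        mul_le_mul_of_nonneg_right ha hb
    _ = ∏ i ∈ s, f i := one_mul _

end Summit.PneNP.PneNP.Theorems.ResNFree
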